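import Summits.HodgeConjecture.HodgeConjecture.Theorems.H413CuspCotComponents
import HarnessLib

/-!
# FLOOR-0 P4, stub T2′ (hol half), part 2/2 — the cohomological family and the TOWER CLASS MAP of a cuspidal cotangent form:
# the theta instance's `towerFamily` / `clsAt` TRANSPORTED to general forms (part 1 = `Theorems/H413CuspCotComponents.lean`)

Cell hodgecm-mathlib (D-0151), FLOOR 0, crux item H413 = stmt-HodgeConjecture-24833; programme P4, line
`Cruxes/H413/Lines/P4AdmissibleOccursInH1.lean` v2.1, stub `stub_T2_matsushimaHodgeAt` («Matsushima–Hodge class map at the factor of record»).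
Author A-p13 (g21).  `--supports stmt-HodgeConjecture-24833`.

The HodgeCM theta lane built, for elements `F` of the slot's adèlic THETA module saturated at `sat(Γ.K)` with holomorphic germs along the
honest archimedean component `archInfOf V`, the component classes `compClass F h ∈ F¹H¹(P_{Γ.conj h})`, the family `towerFamily F ∈ H_K`
(binder-1's `towerLevel`), and the linear, `U(V)(𝔸_f)`-equivariant, level-independent tower class map `clsAt : holSat Γ →ₗ Tower … V`
(`Model/AdelicThetaComponents_{1,2}`, `AdelicThetaTowerClass`, `AdelicThetaTowerAction`, `AdelicThetaTowerMap`).  Reading those proofs, the ONLY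
properties of `F` used are: (L) left invariance under the rational points `(V.latticeModel _).Γ`; (R) right invariance under the saturation
subgroup `satLevelRegimeOf V hV Γ.K`; (W) weight `weightOf x₀` along `archInfOf V ∘ (Stab x₀ ↪ U(2,1))`; (H) `IsHolGerm (archInfOf V) F`.
This file DEFINES the space `cuspCotSat V hV K` of functions `G_U(𝔸) → ℂ²` with (L)(R)(W)(H) — the regime-model avatar of the P0 carrier
`holCotForms (archFactorOf F V)` at level `K` (`Theorems/H413CohFormsCarriers.lean`; the transport along `toLatticeModelG`, P0's
`toLatticeModelG_archFactorOf_ιinf` / `toLatticeModelG_finToAdelic`, is the next file) — and re-runs the template verbatim for it (§1–§2 are part 1, `Theorems/H413CuspCotComponents.lean`; THIS FILE = §3–§4):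

* §1 `rightInvariants`, `cuspCotSat` (+ membership API, antitonicity in `K`, stability under `R_{e_g}` with `Γ ↦ Γ.conj g`);
* §2 components `comp V hV F h = (x ↦ F (archInfOf V x · finToG V hV h))`: weight (`comp_mul_κ₁`), left invariance under the level image of the
  conjugate level (`comp_levelImage_mul`, from `rat_split_level_archInfOf`), hence `comp_mem_weightForms` / `comp_mem_holWeightForms`, descent to a
  unique `(1,0)`-class `compClass` (`pinD … .descends`, `classMapDatumOf_pull_injective`), and the rational-translate identity
  `comp_rationalToFinAdelic_mul` (`exists_archInfOf_mul_mul_finToG_mem_Γ`);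
* §3 `towerFamily` ∈ `towerLevel Γ` (`towerFamily_mem`, binder-1's criterion `mem_towerLevel_of_translate_of_invariant`), `res_towerFamily`;
  behaviour under `R_{e_g}` (`= translate g`), under `Γ' ≤ Γ` (`= restrictLevel`), additivity;
* §4 `clsAt : cuspCotSat V hV Γ.K →ₗ[ℂ] Tower … V` with `of_smul_clsAt` (equivariance, `ℂ[U(V)(𝔸_f)]`-form), `of_smul_clsAt_of_mem`
  (`K`-fixed), `clsAt_of_le` (level independence), `res_clsAt`, and `clsAt_eq_zero_iff` (the class vanishes iff all components vanish —
  `TowerRes.ofLevel_injective` + injectivity of the level class maps).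

What remains for T2′ after this file: the transport `holCotForms (archFactorOf F V) ≃ ⋃_K cuspCotSat V hV K` (currency, P0 §3), the passage
from `clsAt` at SOME level to one map on the union (`clsAt_of_le` + directedness), injectivity on the P0 side (P0-lemmas file
`IsHonest.eq_zero_of_mem_cohForms` + `clsAt_eq_zero_iff`), the `(0,1)` half (complex conjugation on the tower), and `rhoB = act`
(`Representation.ofModule'` round trip) — see the T2-PLAN memo.  Universe records `hHD hI h₁ h₃ hA` are parameters, as in the template.
HC_CM is proved only modulo the 7 printed citations until rung 0 closes; this file proves nothing about them.
[cite: BorelWallach2000, VII 2.10, VII 3.2, VII 3.6; XIII 1.2] [cite: Borel1997, §5.14] [cite: BorelJacquet1979, §4.1–§4.2]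

## References
* [BorelWallach2000] A. Borel, N. Wallach, 2nd ed., VII 2.10/3.2/3.6 (Matsushima, Hodge bigrading), XIII 1.2 (adelic pieces).
* [Borel1997] A. Borel, *Automorphic forms on SL₂(ℝ)*, §5.14 (automorphy-factor dictionary).
* [BorelJacquet1979] A. Borel, H. Jacquet, Corvallis PSPM 33.1, §4.1–§4.2.
* Tree template: HodgeCM `Model/AdelicThetaComponents_1`, `_2`, `AdelicThetaTowerClass`, `AdelicThetaTowerAction`, `AdelicThetaTowerMap`
  (theta instance), `TowerLevel_*`, `TowerCarrier`, `TowerRes`, `LevelTranslate`, `ArchSideInstance`, `ArchSideLevel`, `AdelicThetaModuleFin_1`.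
-/

set_option autoImplicit false
set_option linter.dupNamespace false

noncomputable section

open MulAction NumberField
open Literature.NumberTheory.Automorphic Literature.NumberTheory.Weil1964
open Literature.NumberTheory.Automorphic.WeightForms (restrictHom thetaClasses IsLevelCorrected IsWeightMatched)
open Literature.Geometry.ComplexHyperbolic.BallModel (U21 x₀)
open Literature.AlgebraicGeometry.HodgeTheory Literature.AlgebraicGeometry.ShimuraVarieties
open Literature.NumberTheory.Automorphic.PicardCM
open Literature.NumberTheory.Transcendental (Arapura2012_Cor_15_4_6)
open HodgeCM HodgeCM.Model
open HodgeCM.Model.SupplyResidual HodgeCM.Model.ThetaSpace HodgeCM.Model.LevelTranslate HodgeCM.Model.TowerLevel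
open HodgeCM.Model.TowerCarrier

namespace Summit.HodgeConjecture.HodgeConjecture.Cruxes.H413.CuspCot

variable {L : CMField} {ι₁ : L →+* ℂ} {V : HermSpace3 L ι₁} {hV : IsAnisotropic L V.Hm}

section Pin

variable (hHD : exists_isReal_hodgeModel) (hI : hodgePQ_independent_of_hodgeModel)
  (h₁ : BallQuotientUniformised) (h₃ : CMAbelianVarietyRealised) (hA : Arapura2012_Cor_15_4_6)

/-! ## §3 The cohomological family of `F` is a member of binder-1's `towerLevel Γ` -/

/-- **The cohomological family** of `F`: `h ↦ compClass F h ∈ H¹(P_{Γ.conj h})`. [cite: BorelWallach2000, XIII 1.2] -/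
def towerFamily {Γ : Level V} (hΓ : Γ.BelowConjThree)
    {F : (V.latticeModel printFact_unitaryCompact_holds).G → (Fin 2 → ℂ)} (hF : F ∈ cuspCotSat V hV Γ.K) :
    Π h : V.adelicFin, TowerLevel.W hHD hI (ballQuotientUniformisedDatum_of h₁) h₃ Γ hΓ h :=
  fun h => (compClass hHD hI h₁ h₃ hΓ hF h :
    (picardCMUniverse hHD hI h₁ h₃).CohC ((picardCMUniverse hHD hI h₁ h₃).pms L ι₁ V (Γ.conj h hΓ)) 1)

/-- Unfolding `towerFamily`. [cite: BorelWallach2000, XIII 1.2] -/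
theorem towerFamily_apply {Γ : Level V} (hΓ : Γ.BelowConjThree)
    {F : (V.latticeModel printFact_unitaryCompact_holds).G → (Fin 2 → ℂ)} (hF : F ∈ cuspCotSat V hV Γ.K) (h : V.adelicFin) :
    towerFamily hHD hI h₁ h₃ hΓ hF h = (compClass hHD hI h₁ h₃ hΓ hF h).1 := rfl

/-- **The cohomological family is a member of the level-`K` carrier `towerLevel`** (binder-1's criterion: rational translates and
right-`K`-invariance, both from `comp_rationalToFinAdelic_mul` through `pull_trPull_apply` and the injectivity of the class map).
[cite: BorelWallach2000, XIII 1.2] -/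
theorem towerFamily_mem {Γ : Level V} (hΓ : Γ.BelowConjThree)
    {F : (V.latticeModel printFact_unitaryCompact_holds).G → (Fin 2 → ℂ)} (hF : F ∈ cuspCotSat V hV Γ.K) :
    towerFamily hHD hI h₁ h₃ hΓ hF ∈ towerLevel hHD hI (ballQuotientUniformisedDatum_of h₁) h₃ hA Γ hΓ := by
  refine mem_towerLevel_of_translate_of_invariant hHD hI (ballQuotientUniformisedDatum_of h₁) h₃ hA hΓ _
    (fun γ h => ?_) (fun h kK hk => ?_)
  · refine eq_of_pull_eq hHD hI h₁ h₃ hV (compClass hHD hI h₁ h₃ hΓ hF h)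
      ⟨_, trPull_mem_H10 hHD hI h₁ h₃ hA hV _ (compClass hHD hI h₁ h₃ hΓ hF (ρ V γ * h))⟩ (funext fun x => ?_)
    rw [pull_trPull_apply, pull_compClass, pull_compClass]
    have e := comp_rationalToFinAdelic_mul hF ⟨(γ : GL (Fin 3) L), γ.2⟩ h (one_mem Γ.K) x
    rw [mul_one] at e
    exact e.symm
  · refine eq_of_pull_eq hHD hI h₁ h₃ hV (compClass hHD hI h₁ h₃ hΓ hF h)
      ⟨_, trPull_mem_H10 hHD hI h₁ h₃ hA hV _ (compClass hHD hI h₁ h₃ hΓ hF (h * kK))⟩ (funext fun x => ?_)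
    rw [pull_trPull_apply, pull_compClass, pull_compClass]
    have e := comp_rationalToFinAdelic_mul hF ⟨((1 : ↥(Urat V)) : GL (Fin 3) L), (1 : ↥(Urat V)).2⟩ h hk x
    have e1 : UnitaryGroup.rationalToFinAdelic (↥(maximalRealSubfield L)) (L : Type) (IsCMField.complexConj L) 3 V.Hm
        (UnitaryGroup.ballRational (L : Type) V.Hm ⟨((1 : ↥(Urat V)) : GL (Fin 3) L), (1 : ↥(Urat V)).2⟩) = 1 :=
      map_one (ρ V)
    rw [e1, one_mul] at e
    exact e.symm

/-- **`TowerLevel.res` of the family is THE `(1,0)`-class of `P_Γ` whose harmonic pull-back is `F ∘ archInfOf V`.**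
[cite: BorelWallach2000, VII 3.2] -/
theorem res_towerFamily {Γ : Level V} (hΓ : Γ.BelowConjThree)
    {F : (V.latticeModel printFact_unitaryCompact_holds).G → (Fin 2 → ℂ)} (hF : F ∈ cuspCotSat V hV Γ.K)
    (hc : towerFamily hHD hI h₁ h₃ hΓ hF ∈ towerLevel hHD hI (ballQuotientUniformisedDatum_of h₁) h₃ hA Γ hΓ)
    (cl : (pinD hHD hI h₁ h₃ Γ hV).H10) (hcl : ((pinD hHD hI h₁ h₃ Γ hV).pull cl).1 = F ∘ archInfOf V) :
    TowerLevel.res hHD hI (ballQuotientUniformisedDatum_of h₁) h₃ hA ⟨_, hc⟩ =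
      (cl : (picardCMUniverse hHD hI h₁ h₃).CohC ((picardCMUniverse hHD hI h₁ h₃).pms L ι₁ V Γ) 1) := by
  rw [TowerLevel.res_apply]
  refine (eq_of_pull_eq hHD hI h₁ h₃ hV cl
    ⟨_, trPull_mem_H10 hHD hI h₁ h₃ hA hV _ (compClass hHD hI h₁ h₃ hΓ hF 1)⟩ (funext fun x => ?_)).symm
  rw [pull_trPull_apply, pull_compClass, hcl, ratBall_one, one_mul, comp_apply, map_one, mul_one]
  rfl

/-- **The family of `R_{e_g} F` at level `Γ.conj g` is `translate g` of the family of `F`**, componentwise.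
[cite: BorelWallach2000, XIII 1.2] -/
theorem towerFamily_rightShift {Γ : Level V} (hΓ : Γ.BelowConjThree)
    {F : (V.latticeModel printFact_unitaryCompact_holds).G → (Fin 2 → ℂ)} (hF : F ∈ cuspCotSat V hV Γ.K) (g h : V.adelicFin) :
    towerFamily hHD hI h₁ h₃ (hΓ.conj g) (rightShift_mem_cuspCotSat_conj hΓ hF g) h =
      trPull hHD hI (ballQuotientUniformisedDatum_of h₁) h₃ hA 1 ((Γ.conj g hΓ).conj h (hΓ.conj g)) (Γ.conj (h * g) hΓ)
        (transCond_conj_conj hΓ g h) 1 (towerFamily hHD hI h₁ h₃ hΓ hF (h * g)) := by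
  refine eq_of_pull_eq hHD hI h₁ h₃ hV (compClass hHD hI h₁ h₃ (hΓ.conj g) _ h)
    ⟨_, trPull_mem_H10 hHD hI h₁ h₃ hA hV _ (compClass hHD hI h₁ h₃ hΓ hF (h * g))⟩ (funext fun x => ?_)
  rw [pull_trPull_apply, pull_compClass, pull_compClass, ratBall_one, one_mul]
  exact congrFun (comp_rightShift F g h) x

/-- As members of `towerLevel`: the family of `R_{e_g} F` is `translate g` of the family of `F`. [cite: BorelWallach2000, XIII 1.2] -/
theorem towerFamily_rightShift_eq_translate {Γ : Level V} (hΓ : Γ.BelowConjThree)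
    {F : (V.latticeModel printFact_unitaryCompact_holds).G → (Fin 2 → ℂ)} (hF : F ∈ cuspCotSat V hV Γ.K) (g : V.adelicFin) :
    (⟨_, towerFamily_mem hHD hI h₁ h₃ hA (hΓ.conj g) (rightShift_mem_cuspCotSat_conj hΓ hF g)⟩ :
        towerLevel hHD hI (ballQuotientUniformisedDatum_of h₁) h₃ hA (Γ.conj g hΓ) (hΓ.conj g)) =
      TowerLevel.translate hHD hI (ballQuotientUniformisedDatum_of h₁) h₃ hA hΓ g ⟨_, towerFamily_mem hHD hI h₁ h₃ hA hΓ hF⟩ := by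
  apply Subtype.ext
  funext h
  rw [TowerLevel.translate_apply]
  exact towerFamily_rightShift hHD hI h₁ h₃ hA hΓ hF g h

/-- **`U(V)(𝔸_f)`-EQUIVARIANCE IN THE TOWER**: `ofLevel (Γ.conj g) (family (R_{e_g} F)) = act g (ofLevel Γ (family F))`.
[cite: BorelWallach2000, XIII 1.2] -/
theorem ofLevel_towerFamily_rightShift {Γ : Level V} (hΓ : Γ.BelowConjThree)
    {F : (V.latticeModel printFact_unitaryCompact_holds).G → (Fin 2 → ℂ)} (hF : F ∈ cuspCotSat V hV Γ.K) (g : V.adelicFin) :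
    ofLevel hHD hI (ballQuotientUniformisedDatum_of h₁) h₃ hA (Γ.conj g hΓ) (hΓ.conj g)
        ⟨_, towerFamily_mem hHD hI h₁ h₃ hA (hΓ.conj g) (rightShift_mem_cuspCotSat_conj hΓ hF g)⟩ =
      act hHD hI (ballQuotientUniformisedDatum_of h₁) h₃ hA g
        (ofLevel hHD hI (ballQuotientUniformisedDatum_of h₁) h₃ hA Γ hΓ ⟨_, towerFamily_mem hHD hI h₁ h₃ hA hΓ hF⟩) := by
  rw [act_ofLevel, towerFamily_rightShift_eq_translate hHD hI h₁ h₃ hA hΓ hF g]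

/-- **At a smaller level `Γ' ≤ Γ` the family is `restrictLevel` of the family at `Γ`.** [cite: BorelWallach2000, XIII 1.2] -/
theorem towerFamily_restrictLevel {Γ Γ' : Level V} (hle : Γ' ≤ Γ) (hΓ : Γ.BelowConjThree) (hΓ' : Γ'.BelowConjThree)
    {F : (V.latticeModel printFact_unitaryCompact_holds).G → (Fin 2 → ℂ)} (hF : F ∈ cuspCotSat V hV Γ.K) (h : V.adelicFin) :
    towerFamily hHD hI h₁ h₃ hΓ' (cuspCotSat_anti_level hle hF) h =
      trPull hHD hI (ballQuotientUniformisedDatum_of h₁) h₃ hA 1 (Γ'.conj h hΓ') (Γ.conj h hΓ)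
        (transCond_conj_of_le hle hΓ hΓ' h) 1 (towerFamily hHD hI h₁ h₃ hΓ hF h) := by
  refine eq_of_pull_eq hHD hI h₁ h₃ hV (compClass hHD hI h₁ h₃ hΓ' _ h)
    ⟨_, trPull_mem_H10 hHD hI h₁ h₃ hA hV _ (compClass hHD hI h₁ h₃ hΓ hF h)⟩ (funext fun x => ?_)
  rw [pull_trPull_apply, pull_compClass, pull_compClass, ratBall_one, one_mul]

/-- As members of `towerLevel`: the family at `Γ'` is `restrictLevel` of the family at `Γ`. [cite: BorelWallach2000, XIII 1.2] -/
theorem towerFamily_eq_restrictLevel {Γ Γ' : Level V} (hle : Γ' ≤ Γ) (hΓ : Γ.BelowConjThree) (hΓ' : Γ'.BelowConjThree)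
    {F : (V.latticeModel printFact_unitaryCompact_holds).G → (Fin 2 → ℂ)} (hF : F ∈ cuspCotSat V hV Γ.K) :
    (⟨_, towerFamily_mem hHD hI h₁ h₃ hA hΓ' (cuspCotSat_anti_level hle hF)⟩ :
        towerLevel hHD hI (ballQuotientUniformisedDatum_of h₁) h₃ hA Γ' hΓ') =
      restrictLevel hHD hI (ballQuotientUniformisedDatum_of h₁) h₃ hA hle hΓ hΓ' ⟨_, towerFamily_mem hHD hI h₁ h₃ hA hΓ hF⟩ := by
  apply Subtype.ext
  funext h
  rw [TowerLevel.restrictLevel_apply]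
  exact towerFamily_restrictLevel hHD hI h₁ h₃ hA hle hΓ hΓ' hF h

/-- **The image in the tower does not depend on the level** at which `F` is read. [cite: BorelWallach2000, XIII 1.2] -/
theorem ofLevel_towerFamily_of_le {Γ Γ' : Level V} (hle : Γ' ≤ Γ) (hΓ : Γ.BelowConjThree) (hΓ' : Γ'.BelowConjThree)
    {F : (V.latticeModel printFact_unitaryCompact_holds).G → (Fin 2 → ℂ)} (hF : F ∈ cuspCotSat V hV Γ.K) :
    ofLevel hHD hI (ballQuotientUniformisedDatum_of h₁) h₃ hA Γ' hΓ'
        ⟨_, towerFamily_mem hHD hI h₁ h₃ hA hΓ' (cuspCotSat_anti_level hle hF)⟩ =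
      ofLevel hHD hI (ballQuotientUniformisedDatum_of h₁) h₃ hA Γ hΓ ⟨_, towerFamily_mem hHD hI h₁ h₃ hA hΓ hF⟩ := by
  rw [towerFamily_eq_restrictLevel hHD hI h₁ h₃ hA hle hΓ hΓ' hF, ofLevel_restrictLevel]

/-- The family is additive in `F`. [cite: BorelWallach2000, VII 3.2] -/
theorem towerFamily_add {Γ : Level V} (hΓ : Γ.BelowConjThree)
    {F F' : (V.latticeModel printFact_unitaryCompact_holds).G → (Fin 2 → ℂ)} (hF : F ∈ cuspCotSat V hV Γ.K)
    (hF' : F' ∈ cuspCotSat V hV Γ.K) (h : V.adelicFin) :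
    towerFamily hHD hI h₁ h₃ hΓ (Submodule.add_mem _ hF hF') h =
      towerFamily hHD hI h₁ h₃ hΓ hF h + towerFamily hHD hI h₁ h₃ hΓ hF' h := by
  have e := eq_of_pull_eq hHD hI h₁ h₃ hV (compClass hHD hI h₁ h₃ hΓ (Submodule.add_mem _ hF hF') h)
    (compClass hHD hI h₁ h₃ hΓ hF h + compClass hHD hI h₁ h₃ hΓ hF' h) (by
      rw [map_add, Submodule.coe_add, pull_compClass, pull_compClass, pull_compClass]
      funext x; rfl)
  exact e

/-- The family is homogeneous in `F`. [cite: BorelWallach2000, VII 3.2] -/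
theorem towerFamily_smul {Γ : Level V} (hΓ : Γ.BelowConjThree)
    {F : (V.latticeModel printFact_unitaryCompact_holds).G → (Fin 2 → ℂ)} (hF : F ∈ cuspCotSat V hV Γ.K) (r : ℂ) (h : V.adelicFin) :
    towerFamily hHD hI h₁ h₃ hΓ (Submodule.smul_mem _ r hF) h = r • towerFamily hHD hI h₁ h₃ hΓ hF h := by
  have e := eq_of_pull_eq hHD hI h₁ h₃ hV (compClass hHD hI h₁ h₃ hΓ (Submodule.smul_mem _ r hF) h)
    (r • compClass hHD hI h₁ h₃ hΓ hF h) (by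
      rw [map_smul, Submodule.coe_smul, pull_compClass, pull_compClass]
      funext x; rfl)
  exact e

/-! ## §4 The tower class map at level `Γ` -/

/-- **The tower class map at level `Γ`**: `F ↦ ofLevel Γ (towerFamily F) ∈ Tower … V` on `cuspCotSat V hV Γ.K`, `ℂ`-linear.
[cite: BorelWallach2000, VII 3.2; XIII 1.2] -/
def clsAt (Γ : Level V) (hΓ : Γ.BelowConjThree) :
    ↥(cuspCotSat V hV Γ.K) →ₗ[ℂ] Tower hHD hI (ballQuotientUniformisedDatum_of h₁) h₃ hA V where
  toFun F := ofLevel hHD hI (ballQuotientUniformisedDatum_of h₁) h₃ hA Γ hΓ ⟨_, towerFamily_mem hHD hI h₁ h₃ hA hΓ F.2⟩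
  map_add' F F' := by
    rw [← map_add]
    congr 1
    apply Subtype.ext
    funext h
    exact towerFamily_add hHD hI h₁ h₃ hΓ F.2 F'.2 h
  map_smul' r F := by
    rw [RingHom.id_apply, ← map_smul]
    congr 1
    apply Subtype.ext
    funext h
    exact towerFamily_smul hHD hI h₁ h₃ hΓ F.2 r h

/-- Unfolding `clsAt`. [cite: BorelWallach2000, XIII 1.2] -/
theorem clsAt_apply {Γ : Level V} (hΓ : Γ.BelowConjThree) (F : ↥(cuspCotSat V hV Γ.K)) :
    clsAt hHD hI h₁ h₃ hA Γ hΓ F =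
      ofLevel hHD hI (ballQuotientUniformisedDatum_of h₁) h₃ hA Γ hΓ ⟨_, towerFamily_mem hHD hI h₁ h₃ hA hΓ F.2⟩ := rfl

/-- The class lies in the image of level `K`. [cite: BorelWallach2000, XIII 1.2] -/
theorem clsAt_mem_levelImage {Γ : Level V} (hΓ : Γ.BelowConjThree) (F : ↥(cuspCotSat V hV Γ.K)) :
    clsAt hHD hI h₁ h₃ hA Γ hΓ F ∈ TowerCarrier.levelImage hHD hI (ballQuotientUniformisedDatum_of h₁) h₃ hA Γ hΓ :=
  ofLevel_mem_levelImage hHD hI (ballQuotientUniformisedDatum_of h₁) h₃ hA Γ hΓ _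

/-- **Equivariance**: `clsAt (Γ.conj g) (R_{e_g} F) = act g (clsAt Γ F)`. [cite: BorelWallach2000, XIII 1.2] -/
theorem clsAt_rightShift {Γ : Level V} (hΓ : Γ.BelowConjThree) (F : ↥(cuspCotSat V hV Γ.K)) (g : V.adelicFin) :
    clsAt hHD hI h₁ h₃ hA (Γ.conj g hΓ) (hΓ.conj g) ⟨_, rightShift_mem_cuspCotSat_conj hΓ F.2 g⟩ =
      act hHD hI (ballQuotientUniformisedDatum_of h₁) h₃ hA g (clsAt hHD hI h₁ h₃ hA Γ hΓ F) := by
  rw [clsAt_apply, clsAt_apply, ← ofLevel_towerFamily_rightShift hHD hI h₁ h₃ hA hΓ F.2 g]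

/-- **Equivariance, `ℂ[U(V)(𝔸_f)]`-module form**: `of g • clsAt Γ F = clsAt (Γ.conj g) (R_{e_g} F)`. [cite: BorelWallach2000, XIII 1.2] -/
theorem of_smul_clsAt {Γ : Level V} (hΓ : Γ.BelowConjThree) (F : ↥(cuspCotSat V hV Γ.K)) (g : V.adelicFin) :
    MonoidAlgebra.of ℂ ↥V.adelicFin g • clsAt hHD hI h₁ h₃ hA Γ hΓ F =
      clsAt hHD hI h₁ h₃ hA (Γ.conj g hΓ) (hΓ.conj g) ⟨_, rightShift_mem_cuspCotSat_conj hΓ F.2 g⟩ := by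
  rw [of_smul_eq_act, clsAt_rightShift]

/-- **`K`-fixedness**: `of k • clsAt Γ F = clsAt Γ F` for `k ∈ Γ.K`. [cite: BorelWallach2000, XIII 1.2] -/
theorem of_smul_clsAt_of_mem {Γ : Level V} (hΓ : Γ.BelowConjThree) (F : ↥(cuspCotSat V hV Γ.K)) {kf : V.adelicFin} (hk : kf ∈ Γ.K) :
    MonoidAlgebra.of ℂ ↥V.adelicFin kf • clsAt hHD hI h₁ h₃ hA Γ hΓ F = clsAt hHD hI h₁ h₃ hA Γ hΓ F :=
  of_smul_ofLevel hHD hI (ballQuotientUniformisedDatum_of h₁) h₃ hA hΓ hk _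

/-- **Independence of the level**: reading `F` at a smaller level `Γ' ≤ Γ` gives the same class. [cite: BorelWallach2000, XIII 1.2] -/
theorem clsAt_of_le {Γ Γ' : Level V} (hle : Γ' ≤ Γ) (hΓ : Γ.BelowConjThree) (hΓ' : Γ'.BelowConjThree) (F : ↥(cuspCotSat V hV Γ.K)) :
    clsAt hHD hI h₁ h₃ hA Γ' hΓ' ⟨F.1, cuspCotSat_anti_level hle F.2⟩ = clsAt hHD hI h₁ h₃ hA Γ hΓ F := by
  rw [clsAt_apply, clsAt_apply]
  exact ofLevel_towerFamily_of_le hHD hI h₁ h₃ hA hle hΓ hΓ' F.2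

/-- **Restriction to the identity component**: `res Γ (clsAt Γ F)` is THE `(1,0)`-class of `P_Γ` whose harmonic pull-back is
`F ∘ archInfOf V`. [cite: BorelWallach2000, VII 3.2] -/
theorem res_clsAt {Γ : Level V} (hΓ : Γ.BelowConjThree) (F : ↥(cuspCotSat V hV Γ.K)) (cl : (pinD hHD hI h₁ h₃ Γ hV).H10)
    (hcl : ((pinD hHD hI h₁ h₃ Γ hV).pull cl).1 = F.1 ∘ archInfOf V) :
    TowerCarrier.res hHD hI (ballQuotientUniformisedDatum_of h₁) h₃ hA Γ hΓ (clsAt hHD hI h₁ h₃ hA Γ hΓ F) =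
      (cl : (picardCMUniverse hHD hI h₁ h₃).CohC ((picardCMUniverse hHD hI h₁ h₃).pms L ι₁ V Γ) 1) := by
  rw [clsAt_apply, res_ofLevel]
  exact res_towerFamily hHD hI h₁ h₃ hA hΓ F.2 _ cl hcl

/-- **The class vanishes iff all components vanish** (`ofLevel` is injective, `TowerRes.ofLevel_injective`; the level class maps are
injective).  With P0's `IsHonest.eq_zero_of_mem_cohForms` this is the injectivity of T2′'s class map. [cite: BorelWallach2000, VII 3.2] -/
theorem clsAt_eq_zero_iff {Γ : Level V} (hΓ : Γ.BelowConjThree) (F : ↥(cuspCotSat V hV Γ.K)) :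
    clsAt hHD hI h₁ h₃ hA Γ hΓ F = 0 ↔ ∀ h : V.adelicFin, comp V hV F.1 h = 0 := by
  rw [clsAt_apply, ← map_zero (ofLevel hHD hI (ballQuotientUniformisedDatum_of h₁) h₃ hA Γ hΓ),
    (ofLevel_injective hHD hI (ballQuotientUniformisedDatum_of h₁) h₃ hA Γ hΓ).eq_iff]
  constructor
  · intro h0 h
    have hc : compClass hHD hI h₁ h₃ hΓ F.2 h = 0 := by
      have := congrArg (fun c : towerLevel hHD hI (ballQuotientUniformisedDatum_of h₁) h₃ hA Γ hΓ => c.1 h) h0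
      simp only [Submodule.coe_zero, Pi.zero_apply] at this
      rw [towerFamily_apply] at this
      exact Subtype.ext this
    rw [← pull_compClass hHD hI h₁ h₃ hΓ F.2 h, hc, map_zero]
    rfl
  · intro h0
    apply Subtype.ext
    funext h
    have hc := eq_of_pull_eq hHD hI h₁ h₃ hV (compClass hHD hI h₁ h₃ hΓ F.2 h) 0
      (by rw [pull_compClass, h0 h, map_zero]; rfl)
    show towerFamily hHD hI h₁ h₃ hΓ F.2 h = (0 : Π h' : V.adelicFin, TowerLevel.W hHD hI (ballQuotientUniformisedDatum_of h₁) h₃ Γ hΓ h') h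
    rw [towerFamily_apply, hc]
    rfl

end Pin

end Summit.HodgeConjecture.HodgeConjecture.Cruxes.H413.CuspCot

end
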